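import Summits.BirchSwinnertonDyer.BirchSwinnertonDyer.Theorems.SignedLowerHalvesKobayashiMainConjectureSmallImageCMTransferRecordsA
import HarnessLib

/-!
# Route `SignedLowerHalves`, crux `KobayashiMainConjectureSmallImage` (item stmt-BirchSwinnertonDyer-19002) —
# the CM-congruence transfer line (L4-CM), μ-BINDER records part 10: 4 pairs at `p = 5` (partners `[0,0,0,0,-28]`, `[0,0,0,0,-2]`, `[0,0,0,0,2]`)
# (cell `bsd-ssimc`, seat `bsd-ssimc-k3-c4` gen 2)

HONEST FRAMING: Kobayashi's signed main conjecture at a non-surjective (normaliser-of-non-split-Cartan) image is OPEN; nothing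
here proves it for any class. Every record is CONDITIONAL on (1) the explicitly labelled OPEN binder
`CorpuzLei2025_signedMainConjecture_transfer_OPEN` (Corpuz–Lei arXiv:2508.09733, 2025, UNREFEREED preprint; hypothesis `hCL`,
never asserted), (2) PUBLISHED results BY NAME (`hPR` Pollack–Rubin 2004; `h5`/`h3` period units; Fisher 2012 Thm. 13.2 `hF` / Fisher 2013 Thm. 5.8 `hF'`), and (3) a DISPLAYED
NON-KERNEL binder `hμ'` = unit content of Kobayashi's `L_p^±(E')` for the RANK-≥1 CM partner `E'` (a two-engine CERTIFICATE
from kit j251201 — PARI `ellpadiclambdamu` and the cell's PARI-free modular-symbol engine — quoted per record; NOT the unit case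
of part A). Shape = the tree's class consumer `kobayashiMainConjecture_of_cmPartner_of_transfer_OPEN` (p422273) instantiated
per pair with EVERYTHING ELSE DECIDED IN THE KERNEL: `p ∤ Δ` (both curves), `#Ẽ(𝔽_p) = #Ẽ'(𝔽_p)
= p + 1` (`a_p = 0` both), CM of `E'` (`j ∈ cmJInvariants`), and the congruence `E[p] ≃ E'[p]` by Fisher's Hesse pencils
(modulo Fisher's named facts: `fiveCongruent_of_hesse{,Ind}Certificate`; covariant identities by `norm_num`). The partners' kernel data (point count at `p`, `Δ ≠ 0`, Kraus minimality, CM by `j`) for `[0,0,0,0,-28]`, `[0,0,0,0,-2]`, `[0,0,0,0,2]` are decided in THIS file. The window curves' own ellipticity / minimality enter only as instance binders (Cremona models). Pairs: `421596v1 @ 5` (r_an 0), `416448ba1 @ 5` (r_an 0), `416448bd1 @ 5` (r_an 0), `416448by1 @ 5` (r_an 0). Per pair; item 4 stays OPEN; nothing is booked; BSD is not proved by any of this.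

References: [CorpuzLei2025] Thms 1–3; [PollackRubin2004] Thm. (p. 448); [Kobayashi2003] Conj. (p. 2); [GreenbergVatsal2000] (2),
§3 Rem. 3.4; [Fisher2012Hessian] §8, §13, Thm. 13.2; [Fisher2013QuinticTwists] Thm. 5.8; [SilvermanAEC2009] III §1, VII.1, App. C §11;
[Cremona2006] Table 1.
-/

set_option autoImplicit false
set_option linter.dupNamespace false

noncomputable section

open scoped Classical MatrixGroups ModularForm

open CongruenceSubgroup WeierstrassCurve Literature.NumberTheory.EllipticCurves
  Literature.NumberTheory.EllipticCurves.ModularForms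
  Literature.NumberTheory.EllipticCurves.Kobayashi2003 ZpExtension
  Literature.NumberTheory.EllipticCurves.GreenbergVatsal2000
  Literature.NumberTheory.EllipticCurves.Rank1Residual
  Literature.NumberTheory.EllipticCurves.Rank1Residual.Typed
  Literature.NumberTheory.EllipticCurves.Rank1Residual.X11RankOneCertificates
  Literature.NumberTheory.EllipticCurves.Fisher2012
  Summit.BirchSwinnertonDyer.BirchSwinnertonDyer.Rank1Residual.IntModel
  Summit.BirchSwinnertonDyer.BirchSwinnertonDyer.Rank1Residual.X11RankOne
  Summit.BirchSwinnertonDyer.Rank1Residual.X11b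
  Summit.BirchSwinnertonDyer.Rank1Residual.X9
  Summit.BirchSwinnertonDyer.Rank1Residual.X1
  Summit.BirchSwinnertonDyer.Rank1Residual.Supersingular

namespace Summit.BirchSwinnertonDyer.BirchSwinnertonDyer.Theorems

/-- `#{Ẽ'(𝔽_5)} = 6` for the CM partner `[0,0,0,0,-28] : y² = x³ − 28` (`j = 0`) (`a_5 = 0`: good SUPERSINGULAR; kernel count). [folklore] -/
theorem card_cm0m28_5 :
    Nat.card (((⟨0, 0, 0, 0, -28⟩ : WeierstrassCurve ℤ).map
      (Int.castRingHom (ZMod 5))).toAffine.Point) = 6 := by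
  rw [@WeierstrassCurve.natCard_point_eq_one_add_card (ZMod 5) (@ZMod.instField 5 ⟨by norm_num⟩) _ _ _
    (by decide +kernel), @card_sol_eq_sum_euler (ZMod 5) (@ZMod.instField 5 ⟨by norm_num⟩) _ _
    (by rw [ZMod.ringChar_zmod_n]; decide), ZMod.card]
  decide +kernel

/-- The CM partner `[0,0,0,0,-28] : y² = x³ − 28` (`j = 0`) is an elliptic curve (`Δ ≠ 0`, kernel). [folklore] -/
theorem isElliptic_cm0m28 : (⟨0, 0, 0, 0, -28⟩ : WeierstrassCurve ℚ).IsElliptic :=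
  isElliptic_of_discOf_ne_zero 0 0 0 0 (-28) (by decide +kernel)

/-- The CM partner `[0,0,0,0,-28] : y² = x³ − 28` (`j = 0`) is globally minimal (Kraus' bounded criterion, kernel). [cite: SilvermanAEC2009, VII.1 Remark 1.1] -/
theorem isGloballyMinimal_cm0m28 : (⟨0, 0, 0, 0, -28⟩ : WeierstrassCurve ℚ).IsGloballyMinimal :=
  isGloballyMinimal_of_krausCriterion_bounded₂ 0 0 0 0 (-28) (by decide +kernel) (by decide +kernel)
    (by decide +kernel)

/-- The CM partner `[0,0,0,0,-28] : y² = x³ − 28` (`j = 0`) has CM (`j = 0 ∈` the thirteen CM values), for any globally minimal `A` with this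
integral model. [cite: SilvermanAEC2009, App. C §11] -/
theorem hasCM_cm0m28 {A : WeierstrassCurve ℚ} [A.IsElliptic] [A.IsGloballyMinimal]
    (hIA : integralModelInt A = ⟨0, 0, 0, 0, -28⟩) : A.HasCM :=
  (hasCM_iff_j_mem_holds A).mpr (by rw [j_eq_of_intModel 0 0 0 0 (-28) hIA]; decide +kernel)

/-- `#{Ẽ'(𝔽_5)} = 6` for the CM partner `[0,0,0,0,-2] : y² = x³ − 2` (`j = 0`) (`a_5 = 0`: good SUPERSINGULAR; kernel count). [folklore] -/
theorem card_cm0m2_5 :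
    Nat.card (((⟨0, 0, 0, 0, -2⟩ : WeierstrassCurve ℤ).map
      (Int.castRingHom (ZMod 5))).toAffine.Point) = 6 := by
  rw [@WeierstrassCurve.natCard_point_eq_one_add_card (ZMod 5) (@ZMod.instField 5 ⟨by norm_num⟩) _ _ _
    (by decide +kernel), @card_sol_eq_sum_euler (ZMod 5) (@ZMod.instField 5 ⟨by norm_num⟩) _ _
    (by rw [ZMod.ringChar_zmod_n]; decide), ZMod.card]
  decide +kernel

/-- The CM partner `[0,0,0,0,-2] : y² = x³ − 2` (`j = 0`) is an elliptic curve (`Δ ≠ 0`, kernel). [folklore] -/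
theorem isElliptic_cm0m2 : (⟨0, 0, 0, 0, -2⟩ : WeierstrassCurve ℚ).IsElliptic :=
  isElliptic_of_discOf_ne_zero 0 0 0 0 (-2) (by decide +kernel)

/-- The CM partner `[0,0,0,0,-2] : y² = x³ − 2` (`j = 0`) is globally minimal (Kraus' bounded criterion, kernel). [cite: SilvermanAEC2009, VII.1 Remark 1.1] -/
theorem isGloballyMinimal_cm0m2 : (⟨0, 0, 0, 0, -2⟩ : WeierstrassCurve ℚ).IsGloballyMinimal :=
  isGloballyMinimal_of_krausCriterion_bounded₂ 0 0 0 0 (-2) (by decide +kernel) (by decide +kernel)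
    (by decide +kernel)

/-- The CM partner `[0,0,0,0,-2] : y² = x³ − 2` (`j = 0`) has CM (`j = 0 ∈` the thirteen CM values), for any globally minimal `A` with this
integral model. [cite: SilvermanAEC2009, App. C §11] -/
theorem hasCM_cm0m2 {A : WeierstrassCurve ℚ} [A.IsElliptic] [A.IsGloballyMinimal]
    (hIA : integralModelInt A = ⟨0, 0, 0, 0, -2⟩) : A.HasCM :=
  (hasCM_iff_j_mem_holds A).mpr (by rw [j_eq_of_intModel 0 0 0 0 (-2) hIA]; decide +kernel)

/-- `#{Ẽ'(𝔽_5)} = 6` for the CM partner `[0,0,0,0,2] : y² = x³ + 2` (`j = 0`) (`a_5 = 0`: good SUPERSINGULAR; kernel count). [folklore] -/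
theorem card_cm0p2_5 :
    Nat.card (((⟨0, 0, 0, 0, 2⟩ : WeierstrassCurve ℤ).map
      (Int.castRingHom (ZMod 5))).toAffine.Point) = 6 := by
  rw [@WeierstrassCurve.natCard_point_eq_one_add_card (ZMod 5) (@ZMod.instField 5 ⟨by norm_num⟩) _ _ _
    (by decide +kernel), @card_sol_eq_sum_euler (ZMod 5) (@ZMod.instField 5 ⟨by norm_num⟩) _ _
    (by rw [ZMod.ringChar_zmod_n]; decide), ZMod.card]
  decide +kernel

/-- The CM partner `[0,0,0,0,2] : y² = x³ + 2` (`j = 0`) is an elliptic curve (`Δ ≠ 0`, kernel). [folklore] -/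
theorem isElliptic_cm0p2 : (⟨0, 0, 0, 0, 2⟩ : WeierstrassCurve ℚ).IsElliptic :=
  isElliptic_of_discOf_ne_zero 0 0 0 0 2 (by decide +kernel)

/-- The CM partner `[0,0,0,0,2] : y² = x³ + 2` (`j = 0`) is globally minimal (Kraus' bounded criterion, kernel). [cite: SilvermanAEC2009, VII.1 Remark 1.1] -/
theorem isGloballyMinimal_cm0p2 : (⟨0, 0, 0, 0, 2⟩ : WeierstrassCurve ℚ).IsGloballyMinimal :=
  isGloballyMinimal_of_krausCriterion_bounded₂ 0 0 0 0 2 (by decide +kernel) (by decide +kernel)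
    (by decide +kernel)

/-- The CM partner `[0,0,0,0,2] : y² = x³ + 2` (`j = 0`) has CM (`j = 0 ∈` the thirteen CM values), for any globally minimal `A` with this
integral model. [cite: SilvermanAEC2009, App. C §11] -/
theorem hasCM_cm0p2 {A : WeierstrassCurve ℚ} [A.IsElliptic] [A.IsGloballyMinimal]
    (hIA : integralModelInt A = ⟨0, 0, 0, 0, 2⟩) : A.HasCM :=
  (hasCM_iff_j_mem_holds A).mpr (by rw [j_eq_of_intModel 0 0 0 0 2 hIA]; decide +kernel)

/-- `#{Ẽ(𝔽_5)} = 6` for the Cremona model of `421596v1` (`a_5 = 0`: good SUPERSINGULAR; kernel count).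
[cite: Cremona2006, Table 1 (Cremona label 421596v1)] -/
theorem card_c421596v1_5 :
    Nat.card (((⟨0, 0, 0, -9937095, 12056970254⟩ : WeierstrassCurve ℤ).map
      (Int.castRingHom (ZMod 5))).toAffine.Point) = 6 := by
  rw [@WeierstrassCurve.natCard_point_eq_one_add_card (ZMod 5) (@ZMod.instField 5 ⟨by norm_num⟩) _ _ _
    (by decide +kernel), @card_sol_eq_sum_euler (ZMod 5) (@ZMod.instField 5 ⟨by norm_num⟩) _ _
    (by rw [ZMod.ringChar_zmod_n]; decide), ZMod.card]
  decide +kernel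

/-- **Kobayashi's ± main conjecture, BOTH signs, for `421596v1 @ 5`** (Cremona model `[0, 0, 0, -9937095, 12056970254]`, `N = 421596 = 2²·3²·7²·239`,
`r_an = 0`; item-4 pair: X7, `a_5 = 0`, image `5Nn`) **by CM-congruence transfer from the RANK-1 CM partner
`E' =` `[0,0,0,0,-28] : y² = x³ − 28` (`j = 0`) (conductor `1764`), MODULO the OPEN binder `hCL` (Corpuz–Lei 2025, PRE) AND the displayed
`μ`-BINDER `hμ'`** (unit content of `L_p^±(E')` — NOT a kernel fact; certificate: kit j251201 — engine A PARI `ellpadiclambdamu(E',5) = [[1, 1], [0, 0]]`; engine B (cell's PARI-free modular-symbol engine) Mazur–Tate layers: even-Pollack-index top n=3 μ=0 λ−q=1, odd top n=2 μ=0 λ−q=1 — TWO engines agree μ^± = 0; partner conductor 1764, analytic rank 1). `E ≅_ℚ` the member `(λ:μ) = (12:1)` of the indirect family `X⁻_{E'}(5)`, `u = 433421549568` (`fiveCongruent_of_hesseIndCertificate`, modulo Fisher 2013 Thm. 5.8 `hF'`);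
covariant identities by `norm_num`. BY NAME: `hPR`, `h5`, `h3`, `hF'`. Kernel-decided (models as instance binders): `5 ∤ Δ` (both),
`#Ẽ(𝔽_5) = #Ẽ'(𝔽_5) = 6`, CM of `E'`. Per pair; item 4 stays OPEN; nothing booked.
[claim: CorpuzLei2025, status: under-review] [cite: PollackRubin2004, Theorem (p. 448) = Thm. 7.3]
[cite: Fisher2013QuinticTwists, Thm. 5.8] [cite: Cremona2006, Table 1 (Cremona label 421596v1)] -/
theorem kobayashiMainConjecture_c421596v1_5_of_mu_of_transfer_OPEN
    (hCL : CorpuzLei2025_signedMainConjecture_transfer_OPEN)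
    (hPR : PollackRubin2004.mainTheorem_signedCharIdeal_eq_of_cm)
    (h5 : realPeriodRat_eq_unit_mul_plusPeriod) (h3 : realPeriodRat_eq_unit_mul_plusPeriod_three)
    (hF' : thm58_fiveCongruent_hessePencilInd)
    (W A : WeierstrassCurve ℚ) [W.IsElliptic] [W.IsGloballyMinimal] [A.IsElliptic] [A.IsGloballyMinimal]
    [Fact (Nat.Prime 5)] (hW : W = ⟨0, 0, 0, -9937095, 12056970254⟩) (hA : A = ⟨0, 0, 0, 0, -28⟩)
    (hμ' : ∀ [NeZero (A.conductorNorm ℤ)] (f' : CuspForm (Gamma0 (A.conductorNorm ℤ)) 2),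
      IsNewformOf A f' → ∀ (Lplus Lminus : IwasawaAlgebra 5), IsPollackPair f' 5 Lplus Lminus →
      ∀ ε : ℤˣ, HasUnitContent (kobayashiL ε Lplus Lminus)) (ε : ℤˣ) :
    KobayashiMainConjecture W 5 ε := by
  have hIW : integralModelInt W = ⟨0, 0, 0, -9937095, 12056970254⟩ :=
    integralModelInt_eq_of_map_eq _ (by rw [hW]; ext <;> simp [WeierstrassCurve.map])
  have hIA : integralModelInt A = ⟨0, 0, 0, 0, -28⟩ :=
    integralModelInt_eq_of_map_eq _ (by rw [hA]; ext <;> simp [WeierstrassCurve.map])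
  have hΔ : (⟨0, 0, 0, -9937095, 12056970254⟩ : WeierstrassCurve ℤ).Δ = discOf [0, 0, 0, -9937095, 12056970254] :=
    intCurve_Δ 0 0 0 (-9937095) 12056970254
  have hΔA : (⟨0, 0, 0, 0, -28⟩ : WeierstrassCurve ℤ).Δ = discOf [0, 0, 0, 0, -28] :=
    intCurve_Δ 0 0 0 0 (-28)
  have hgood : W.HasGoodReductionAtPrime 5 :=
    hasGoodReductionAtPrime_of_not_dvd W 5 (by rw [minimalDiscriminantInt_eq hIW, hΔ]; decide +kernel)
  have hgoodA : A.HasGoodReductionAtPrime 5 :=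
    hasGoodReductionAtPrime_of_not_dvd A 5 (by rw [minimalDiscriminantInt_eq hIA, hΔA]; decide +kernel)
  have hap : W.frobeniusTrace 5 = 0 := by rw [frobeniusTrace_eq hIW card_c421596v1_5]; norm_num
  have hapA : A.frobeniusTrace 5 = 0 := by rw [frobeniusTrace_eq hIA card_cm0m28_5]; norm_num
  have hc4 : W.c₄ = (476980560 : ℚ) := by
    subst hW; norm_num [WeierstrassCurve.c₄, WeierstrassCurve.b₂, WeierstrassCurve.b₄]
  have hc6 : W.c₆ = (-10417222299456 : ℚ) := by
    subst hW; norm_num [WeierstrassCurve.c₆, WeierstrassCurve.b₂, WeierstrassCurve.b₄, WeierstrassCurve.b₆]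
  have hc4A : A.c₄ = (0 : ℚ) := by
    subst hA; norm_num [WeierstrassCurve.c₄, WeierstrassCurve.b₂, WeierstrassCurve.b₄]
  have hc6A : A.c₆ = (24192 : ℚ) := by
    subst hA; norm_num [WeierstrassCurve.c₆, WeierstrassCurve.b₂, WeierstrassCurve.b₄, WeierstrassCurve.b₆]
  have hiso := fiveCongruent_of_hesseIndCertificate hF' A W (12 : ℚ) 1 (433421549568 : ℚ)
    (by norm_num) (by rw [hc4A, hc6A, hc4, eval_hesseC4ind]; norm_num)
    (by rw [hc4A, hc6A, hc6, eval_hesseC6ind]; norm_num)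
  exact kobayashiMainConjecture_of_cmPartner_of_transfer_OPEN W A 5 hCL hPR h5 h3 (by norm_num) hgood hap
    (hasCM_cm0m28 hIA) ⟨hgoodA, by rw [hapA]; exact dvd_zero _⟩ hapA hiso hμ' ε

/-- `#{Ẽ(𝔽_5)} = 6` for the Cremona model of `416448ba1` (`a_5 = 0`: good SUPERSINGULAR; kernel count).
[cite: Cremona2006, Table 1 (Cremona label 416448ba1)] -/
theorem card_c416448ba1_5 :
    Nat.card (((⟨0, 0, 0, -184440, -30964394⟩ : WeierstrassCurve ℤ).map
      (Int.castRingHom (ZMod 5))).toAffine.Point) = 6 := by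
  rw [@WeierstrassCurve.natCard_point_eq_one_add_card (ZMod 5) (@ZMod.instField 5 ⟨by norm_num⟩) _ _ _
    (by decide +kernel), @card_sol_eq_sum_euler (ZMod 5) (@ZMod.instField 5 ⟨by norm_num⟩) _ _
    (by rw [ZMod.ringChar_zmod_n]; decide), ZMod.card]
  decide +kernel

/-- **Kobayashi's ± main conjecture, BOTH signs, for `416448ba1 @ 5`** (Cremona model `[0, 0, 0, -184440, -30964394]`, `N = 416448 = 2⁶·3³·241`,
`r_an = 0`; item-4 pair: X7, `a_5 = 0`, image `5Nn`) **by CM-congruence transfer from the RANK-1 CM partner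
`E' =` `[0,0,0,0,-2] : y² = x³ − 2` (`j = 0`) (conductor `1728`), MODULO the OPEN binder `hCL` (Corpuz–Lei 2025, PRE) AND the displayed
`μ`-BINDER `hμ'`** (unit content of `L_p^±(E')` — NOT a kernel fact; certificate: kit j251201 — engine A PARI `ellpadiclambdamu(E',5) = [[1, 1], [0, 0]]`; engine B (cell's PARI-free modular-symbol engine) Mazur–Tate layers: even-Pollack-index top n=3 μ=0 λ−q=1, odd top n=2 μ=0 λ−q=1 — TWO engines agree μ^± = 0; partner conductor 1728, analytic rank 1). `E ≅_ℚ` the member `(λ:μ) = (24:1)` of the indirect family `X⁻_{E'}(5)`, `u = 10319560704` (`fiveCongruent_of_hesseIndCertificate`, modulo Fisher 2013 Thm. 5.8 `hF'`);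
covariant identities by `norm_num`. BY NAME: `hPR`, `h5`, `h3`, `hF'`. Kernel-decided (models as instance binders): `5 ∤ Δ` (both),
`#Ẽ(𝔽_5) = #Ẽ'(𝔽_5) = 6`, CM of `E'`. Per pair; item 4 stays OPEN; nothing booked.
[claim: CorpuzLei2025, status: under-review] [cite: PollackRubin2004, Theorem (p. 448) = Thm. 7.3]
[cite: Fisher2013QuinticTwists, Thm. 5.8] [cite: Cremona2006, Table 1 (Cremona label 416448ba1)] -/
theorem kobayashiMainConjecture_c416448ba1_5_of_mu_of_transfer_OPEN
    (hCL : CorpuzLei2025_signedMainConjecture_transfer_OPEN)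
    (hPR : PollackRubin2004.mainTheorem_signedCharIdeal_eq_of_cm)
    (h5 : realPeriodRat_eq_unit_mul_plusPeriod) (h3 : realPeriodRat_eq_unit_mul_plusPeriod_three)
    (hF' : thm58_fiveCongruent_hessePencilInd)
    (W A : WeierstrassCurve ℚ) [W.IsElliptic] [W.IsGloballyMinimal] [A.IsElliptic] [A.IsGloballyMinimal]
    [Fact (Nat.Prime 5)] (hW : W = ⟨0, 0, 0, -184440, -30964394⟩) (hA : A = ⟨0, 0, 0, 0, -2⟩)
    (hμ' : ∀ [NeZero (A.conductorNorm ℤ)] (f' : CuspForm (Gamma0 (A.conductorNorm ℤ)) 2),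
      IsNewformOf A f' → ∀ (Lplus Lminus : IwasawaAlgebra 5), IsPollackPair f' 5 Lplus Lminus →
      ∀ ε : ℤˣ, HasUnitContent (kobayashiL ε Lplus Lminus)) (ε : ℤˣ) :
    KobayashiMainConjecture W 5 ε := by
  have hIW : integralModelInt W = ⟨0, 0, 0, -184440, -30964394⟩ :=
    integralModelInt_eq_of_map_eq _ (by rw [hW]; ext <;> simp [WeierstrassCurve.map])
  have hIA : integralModelInt A = ⟨0, 0, 0, 0, -2⟩ :=
    integralModelInt_eq_of_map_eq _ (by rw [hA]; ext <;> simp [WeierstrassCurve.map])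
  have hΔ : (⟨0, 0, 0, -184440, -30964394⟩ : WeierstrassCurve ℤ).Δ = discOf [0, 0, 0, -184440, -30964394] :=
    intCurve_Δ 0 0 0 (-184440) (-30964394)
  have hΔA : (⟨0, 0, 0, 0, -2⟩ : WeierstrassCurve ℤ).Δ = discOf [0, 0, 0, 0, -2] :=
    intCurve_Δ 0 0 0 0 (-2)
  have hgood : W.HasGoodReductionAtPrime 5 :=
    hasGoodReductionAtPrime_of_not_dvd W 5 (by rw [minimalDiscriminantInt_eq hIW, hΔ]; decide +kernel)
  have hgoodA : A.HasGoodReductionAtPrime 5 :=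
    hasGoodReductionAtPrime_of_not_dvd A 5 (by rw [minimalDiscriminantInt_eq hIA, hΔA]; decide +kernel)
  have hap : W.frobeniusTrace 5 = 0 := by rw [frobeniusTrace_eq hIW card_c416448ba1_5]; norm_num
  have hapA : A.frobeniusTrace 5 = 0 := by rw [frobeniusTrace_eq hIA card_cm0m2_5]; norm_num
  have hc4 : W.c₄ = (8853120 : ℚ) := by
    subst hW; norm_num [WeierstrassCurve.c₄, WeierstrassCurve.b₂, WeierstrassCurve.b₄]
  have hc6 : W.c₆ = (26753236416 : ℚ) := by
    subst hW; norm_num [WeierstrassCurve.c₆, WeierstrassCurve.b₂, WeierstrassCurve.b₄, WeierstrassCurve.b₆]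
  have hc4A : A.c₄ = (0 : ℚ) := by
    subst hA; norm_num [WeierstrassCurve.c₄, WeierstrassCurve.b₂, WeierstrassCurve.b₄]
  have hc6A : A.c₆ = (1728 : ℚ) := by
    subst hA; norm_num [WeierstrassCurve.c₆, WeierstrassCurve.b₂, WeierstrassCurve.b₄, WeierstrassCurve.b₆]
  have hiso := fiveCongruent_of_hesseIndCertificate hF' A W (24 : ℚ) 1 (10319560704 : ℚ)
    (by norm_num) (by rw [hc4A, hc6A, hc4, eval_hesseC4ind]; norm_num)
    (by rw [hc4A, hc6A, hc6, eval_hesseC6ind]; norm_num)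
  exact kobayashiMainConjecture_of_cmPartner_of_transfer_OPEN W A 5 hCL hPR h5 h3 (by norm_num) hgood hap
    (hasCM_cm0m2 hIA) ⟨hgoodA, by rw [hapA]; exact dvd_zero _⟩ hapA hiso hμ' ε

/-- `#{Ẽ(𝔽_5)} = 6` for the Cremona model of `416448bd1` (`a_5 = 0`: good SUPERSINGULAR; kernel count).
[cite: Cremona2006, Table 1 (Cremona label 416448bd1)] -/
theorem card_c416448bd1_5 :
    Nat.card (((⟨0, 0, 0, -1659960, 836038638⟩ : WeierstrassCurve ℤ).map
      (Int.castRingHom (ZMod 5))).toAffine.Point) = 6 := by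
  rw [@WeierstrassCurve.natCard_point_eq_one_add_card (ZMod 5) (@ZMod.instField 5 ⟨by norm_num⟩) _ _ _
    (by decide +kernel), @card_sol_eq_sum_euler (ZMod 5) (@ZMod.instField 5 ⟨by norm_num⟩) _ _
    (by rw [ZMod.ringChar_zmod_n]; decide), ZMod.card]
  decide +kernel

/-- **Kobayashi's ± main conjecture, BOTH signs, for `416448bd1 @ 5`** (Cremona model `[0, 0, 0, -1659960, 836038638]`, `N = 416448 = 2⁶·3³·241`,
`r_an = 0`; item-4 pair: X7, `a_5 = 0`, image `5Nn`) **by CM-congruence transfer from the RANK-1 CM partner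
`E' =` `[0,0,0,0,-2] : y² = x³ − 2` (`j = 0`) (conductor `1728`), MODULO the OPEN binder `hCL` (Corpuz–Lei 2025, PRE) AND the displayed
`μ`-BINDER `hμ'`** (unit content of `L_p^±(E')` — NOT a kernel fact; certificate: kit j251201 — engine A PARI `ellpadiclambdamu(E',5) = [[1, 1], [0, 0]]`; engine B (cell's PARI-free modular-symbol engine) Mazur–Tate layers: even-Pollack-index top n=3 μ=0 λ−q=1, odd top n=2 μ=0 λ−q=1 — TWO engines agree μ^± = 0; partner conductor 1728, analytic rank 1). `E ≅_ℚ` the member `(λ:μ) = (-48:1)` of `X_{E'}(5)`, `u = 23887872` (`fiveCongruent_of_hesseCertificate`, modulo Fisher 2012 Thm. 13.2 `hF`);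
covariant identities by `norm_num`. BY NAME: `hPR`, `h5`, `h3`, `hF`. Kernel-decided (models as instance binders): `5 ∤ Δ` (both),
`#Ẽ(𝔽_5) = #Ẽ'(𝔽_5) = 6`, CM of `E'`. Per pair; item 4 stays OPEN; nothing booked.
[claim: CorpuzLei2025, status: under-review] [cite: PollackRubin2004, Theorem (p. 448) = Thm. 7.3]
[cite: Fisher2012Hessian, Thm. 13.2 (n = 5)] [cite: Cremona2006, Table 1 (Cremona label 416448bd1)] -/
theorem kobayashiMainConjecture_c416448bd1_5_of_mu_of_transfer_OPEN
    (hCL : CorpuzLei2025_signedMainConjecture_transfer_OPEN)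
    (hPR : PollackRubin2004.mainTheorem_signedCharIdeal_eq_of_cm)
    (h5 : realPeriodRat_eq_unit_mul_plusPeriod) (h3 : realPeriodRat_eq_unit_mul_plusPeriod_three)
    (hF : thm132_fiveCongruent_hessePencil)
    (W A : WeierstrassCurve ℚ) [W.IsElliptic] [W.IsGloballyMinimal] [A.IsElliptic] [A.IsGloballyMinimal]
    [Fact (Nat.Prime 5)] (hW : W = ⟨0, 0, 0, -1659960, 836038638⟩) (hA : A = ⟨0, 0, 0, 0, -2⟩)
    (hμ' : ∀ [NeZero (A.conductorNorm ℤ)] (f' : CuspForm (Gamma0 (A.conductorNorm ℤ)) 2),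
      IsNewformOf A f' → ∀ (Lplus Lminus : IwasawaAlgebra 5), IsPollackPair f' 5 Lplus Lminus →
      ∀ ε : ℤˣ, HasUnitContent (kobayashiL ε Lplus Lminus)) (ε : ℤˣ) :
    KobayashiMainConjecture W 5 ε := by
  have hIW : integralModelInt W = ⟨0, 0, 0, -1659960, 836038638⟩ :=
    integralModelInt_eq_of_map_eq _ (by rw [hW]; ext <;> simp [WeierstrassCurve.map])
  have hIA : integralModelInt A = ⟨0, 0, 0, 0, -2⟩ :=
    integralModelInt_eq_of_map_eq _ (by rw [hA]; ext <;> simp [WeierstrassCurve.map])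
  have hΔ : (⟨0, 0, 0, -1659960, 836038638⟩ : WeierstrassCurve ℤ).Δ = discOf [0, 0, 0, -1659960, 836038638] :=
    intCurve_Δ 0 0 0 (-1659960) 836038638
  have hΔA : (⟨0, 0, 0, 0, -2⟩ : WeierstrassCurve ℤ).Δ = discOf [0, 0, 0, 0, -2] :=
    intCurve_Δ 0 0 0 0 (-2)
  have hgood : W.HasGoodReductionAtPrime 5 :=
    hasGoodReductionAtPrime_of_not_dvd W 5 (by rw [minimalDiscriminantInt_eq hIW, hΔ]; decide +kernel)
  have hgoodA : A.HasGoodReductionAtPrime 5 :=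
    hasGoodReductionAtPrime_of_not_dvd A 5 (by rw [minimalDiscriminantInt_eq hIA, hΔA]; decide +kernel)
  have hap : W.frobeniusTrace 5 = 0 := by rw [frobeniusTrace_eq hIW card_c416448bd1_5]; norm_num
  have hapA : A.frobeniusTrace 5 = 0 := by rw [frobeniusTrace_eq hIA card_cm0m2_5]; norm_num
  have hc4 : W.c₄ = (79678080 : ℚ) := by
    subst hW; norm_num [WeierstrassCurve.c₄, WeierstrassCurve.b₂, WeierstrassCurve.b₄]
  have hc6 : W.c₆ = (-722337383232 : ℚ) := by
    subst hW; norm_num [WeierstrassCurve.c₆, WeierstrassCurve.b₂, WeierstrassCurve.b₄, WeierstrassCurve.b₆]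
  have hc4A : A.c₄ = (0 : ℚ) := by
    subst hA; norm_num [WeierstrassCurve.c₄, WeierstrassCurve.b₂, WeierstrassCurve.b₄]
  have hc6A : A.c₆ = (1728 : ℚ) := by
    subst hA; norm_num [WeierstrassCurve.c₆, WeierstrassCurve.b₂, WeierstrassCurve.b₄, WeierstrassCurve.b₆]
  have hiso := fiveCongruent_of_hesseCertificate hF A W (-48 : ℚ) 1 (23887872 : ℚ)
    (by norm_num) (by rw [hc4A, hc6A, hc4, eval_hesseC4]; norm_num)
    (by rw [hc4A, hc6A, hc6, eval_hesseC6]; norm_num)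
  exact kobayashiMainConjecture_of_cmPartner_of_transfer_OPEN W A 5 hCL hPR h5 h3 (by norm_num) hgood hap
    (hasCM_cm0m2 hIA) ⟨hgoodA, by rw [hapA]; exact dvd_zero _⟩ hapA hiso hμ' ε

/-- `#{Ẽ(𝔽_5)} = 6` for the Cremona model of `416448by1` (`a_5 = 0`: good SUPERSINGULAR; kernel count).
[cite: Cremona2006, Table 1 (Cremona label 416448by1)] -/
theorem card_c416448by1_5 :
    Nat.card (((⟨0, 0, 0, -1659960, -836038638⟩ : WeierstrassCurve ℤ).map
      (Int.castRingHom (ZMod 5))).toAffine.Point) = 6 := by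
  rw [@WeierstrassCurve.natCard_point_eq_one_add_card (ZMod 5) (@ZMod.instField 5 ⟨by norm_num⟩) _ _ _
    (by decide +kernel), @card_sol_eq_sum_euler (ZMod 5) (@ZMod.instField 5 ⟨by norm_num⟩) _ _
    (by rw [ZMod.ringChar_zmod_n]; decide), ZMod.card]
  decide +kernel

/-- **Kobayashi's ± main conjecture, BOTH signs, for `416448by1 @ 5`** (Cremona model `[0, 0, 0, -1659960, -836038638]`, `N = 416448 = 2⁶·3³·241`,
`r_an = 0`; item-4 pair: X7, `a_5 = 0`, image `5Nn`) **by CM-congruence transfer from the RANK-1 CM partner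
`E' =` `[0,0,0,0,2] : y² = x³ + 2` (`j = 0`) (conductor `1728`), MODULO the OPEN binder `hCL` (Corpuz–Lei 2025, PRE) AND the displayed
`μ`-BINDER `hμ'`** (unit content of `L_p^±(E')` — NOT a kernel fact; certificate: kit j251201 — engine A PARI `ellpadiclambdamu(E',5) = [[1, 1], [0, 0]]`; engine B (cell's PARI-free modular-symbol engine) Mazur–Tate layers: even-Pollack-index top n=3 μ=0 λ−q=1, odd top n=2 μ=0 λ−q=1 — TWO engines agree μ^± = 0; partner conductor 1728, analytic rank 1). `E ≅_ℚ` the member `(λ:μ) = (48:1)` of `X_{E'}(5)`, `u = 23887872` (`fiveCongruent_of_hesseCertificate`, modulo Fisher 2012 Thm. 13.2 `hF`);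
covariant identities by `norm_num`. BY NAME: `hPR`, `h5`, `h3`, `hF`. Kernel-decided (models as instance binders): `5 ∤ Δ` (both),
`#Ẽ(𝔽_5) = #Ẽ'(𝔽_5) = 6`, CM of `E'`. Per pair; item 4 stays OPEN; nothing booked.
[claim: CorpuzLei2025, status: under-review] [cite: PollackRubin2004, Theorem (p. 448) = Thm. 7.3]
[cite: Fisher2012Hessian, Thm. 13.2 (n = 5)] [cite: Cremona2006, Table 1 (Cremona label 416448by1)] -/
theorem kobayashiMainConjecture_c416448by1_5_of_mu_of_transfer_OPEN
    (hCL : CorpuzLei2025_signedMainConjecture_transfer_OPEN)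
    (hPR : PollackRubin2004.mainTheorem_signedCharIdeal_eq_of_cm)
    (h5 : realPeriodRat_eq_unit_mul_plusPeriod) (h3 : realPeriodRat_eq_unit_mul_plusPeriod_three)
    (hF : thm132_fiveCongruent_hessePencil)
    (W A : WeierstrassCurve ℚ) [W.IsElliptic] [W.IsGloballyMinimal] [A.IsElliptic] [A.IsGloballyMinimal]
    [Fact (Nat.Prime 5)] (hW : W = ⟨0, 0, 0, -1659960, -836038638⟩) (hA : A = ⟨0, 0, 0, 0, 2⟩)
    (hμ' : ∀ [NeZero (A.conductorNorm ℤ)] (f' : CuspForm (Gamma0 (A.conductorNorm ℤ)) 2),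
      IsNewformOf A f' → ∀ (Lplus Lminus : IwasawaAlgebra 5), IsPollackPair f' 5 Lplus Lminus →
      ∀ ε : ℤˣ, HasUnitContent (kobayashiL ε Lplus Lminus)) (ε : ℤˣ) :
    KobayashiMainConjecture W 5 ε := by
  have hIW : integralModelInt W = ⟨0, 0, 0, -1659960, -836038638⟩ :=
    integralModelInt_eq_of_map_eq _ (by rw [hW]; ext <;> simp [WeierstrassCurve.map])
  have hIA : integralModelInt A = ⟨0, 0, 0, 0, 2⟩ :=
    integralModelInt_eq_of_map_eq _ (by rw [hA]; ext <;> simp [WeierstrassCurve.map])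
  have hΔ : (⟨0, 0, 0, -1659960, -836038638⟩ : WeierstrassCurve ℤ).Δ = discOf [0, 0, 0, -1659960, -836038638] :=
    intCurve_Δ 0 0 0 (-1659960) (-836038638)
  have hΔA : (⟨0, 0, 0, 0, 2⟩ : WeierstrassCurve ℤ).Δ = discOf [0, 0, 0, 0, 2] :=
    intCurve_Δ 0 0 0 0 2
  have hgood : W.HasGoodReductionAtPrime 5 :=
    hasGoodReductionAtPrime_of_not_dvd W 5 (by rw [minimalDiscriminantInt_eq hIW, hΔ]; decide +kernel)
  have hgoodA : A.HasGoodReductionAtPrime 5 :=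
    hasGoodReductionAtPrime_of_not_dvd A 5 (by rw [minimalDiscriminantInt_eq hIA, hΔA]; decide +kernel)
  have hap : W.frobeniusTrace 5 = 0 := by rw [frobeniusTrace_eq hIW card_c416448by1_5]; norm_num
  have hapA : A.frobeniusTrace 5 = 0 := by rw [frobeniusTrace_eq hIA card_cm0p2_5]; norm_num
  have hc4 : W.c₄ = (79678080 : ℚ) := by
    subst hW; norm_num [WeierstrassCurve.c₄, WeierstrassCurve.b₂, WeierstrassCurve.b₄]
  have hc6 : W.c₆ = (722337383232 : ℚ) := by
    subst hW; norm_num [WeierstrassCurve.c₆, WeierstrassCurve.b₂, WeierstrassCurve.b₄, WeierstrassCurve.b₆]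
  have hc4A : A.c₄ = (0 : ℚ) := by
    subst hA; norm_num [WeierstrassCurve.c₄, WeierstrassCurve.b₂, WeierstrassCurve.b₄]
  have hc6A : A.c₆ = (-1728 : ℚ) := by
    subst hA; norm_num [WeierstrassCurve.c₆, WeierstrassCurve.b₂, WeierstrassCurve.b₄, WeierstrassCurve.b₆]
  have hiso := fiveCongruent_of_hesseCertificate hF A W (48 : ℚ) 1 (23887872 : ℚ)
    (by norm_num) (by rw [hc4A, hc6A, hc4, eval_hesseC4]; norm_num)
    (by rw [hc4A, hc6A, hc6, eval_hesseC6]; norm_num)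
  exact kobayashiMainConjecture_of_cmPartner_of_transfer_OPEN W A 5 hCL hPR h5 h3 (by norm_num) hgood hap
    (hasCM_cm0p2 hIA) ⟨hgoodA, by rw [hapA]; exact dvd_zero _⟩ hapA hiso hμ' ε

end Summit.BirchSwinnertonDyer.BirchSwinnertonDyer.Theorems

end
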